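import Literature.AnabelianGeometry.EtaleTheta.ThetaSubquotientOfTempered

/-!
# [EtTh] §5: theta subquotients over `B^temp(Π)⁰` — evaluation at a point, functoriality, Galois

Mochizuki, *The étale theta function and its Frobenioid-theoretic manifestations*, Publ. RIMS **45**
(2009), §5 p. 327 (PDF p. 101) and the proof of Prop. 5.5, p. 328 (PDF p. 102)
[cite: MochizukiEtTh2009, §5 p.327 (PDF p.101)].  abc-iut cell, layer L2, seat abc-iut-L2-t9 (unit
W2-L2-05; companion to `ThetaSubquotientOfTempered.lean`, reading R2 of the §5 owner abc-iut-L2-t4).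
Staged 2026-08-25T23:30Z by abc-iut-L2-t9 (gen 2) and filed verbatim (minus the two functoriality lemmas, see
below) with credit by abc-iut-w4-d042 (gen 3), MERGE-PLAN row 2 (D).

For a CONNECTED object `E` of `B^temp(Π)` and a point `x ∈ E` with stabiliser `S = Stab(x)`:

* `evalAt x : (l·Δ_Θ)_E → Λ/J(S)` (evaluate a compatible family at `x`) is an ISOMORPHISM
  (`evalAt_injective`, `evalAt_surjective`, `evalEquiv`): the point-free carrier of
  `ThetaSubquotientOfTempered.lean` is the carrier `Λ/J(Stab x)` of `ThetaSubquotientGroup.lean` at any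
  point;
* under these identifications the transport `map f` along `f : E → E'` is the natural surjection
  `Λ/J(Stab x) ↠ Λ/J(Stab (f x))` (`evalAt_map`, `map_surjective`) — print's "linear morphisms `S'' → S` …
  induce [surjections, and by Def. 5.4 (b) and `modPowMap_bijective_of_card_eq`] isomorphisms
  `(l·Δ_Θ)_{S''} ⊗ ℤ/Nℤ ⥲ (l·Δ_Θ)_S ⊗ ℤ/Nℤ`" (p. 328), the lemma requested by abc-iut-L2-t4 for
  `LinearlyReachableFromBN` / `rigidityFamily_unique_of`;
* `map` is functorial (`ThetaSubquotient.map_id`, `ThetaSubquotient.map_comp` — in the tree since p418890,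
  `Discharge/Sec5TransportLaws.lean`, not restated here) — so `thetaSubquotientStub` is a functor, although the
  stub records no laws;
* at a GALOIS point (`Stab(x) = N` with `q(N)` normal, e.g. `N` normal and `q` surjective) the carrier is
  `Λ/ι⁻¹(q(N) ∩ L)`, print's `L·q(N)/q(N) ⊆ Q/q(N) = Aut^Θ_D(Π/N)` (`kill_eq_of_normal`,
  `ThetaSubquotientGroup.killQ_eq_of_normal`).

HONEST FRAMING as in the companion files: at non-Galois objects the carrier is the coinvariant enlargement
of print's subquotient-of-`Aut`; nothing is asserted about [EtTh]'s curves.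
-/

noncomputable section

namespace Literature.AnabelianGeometry.EtaleTheta

namespace ThetaSubquotient

open CategoryTheory Literature.AlgebraicGeometry.Frobenioids Literature.AnabelianGeometry.SemiGraphs
open Literature.AlgebraicGeometry.Frobenioids.QuasiTemperoid (stabilizerSubgroup)
open Literature.AlgebraicGeometry.Frobenioids.QuasiTemperoid.BTempConnected (hom_ρ ρ_mul_apply
  ρ_one_apply ρ_inv_apply ρ_apply_inv exists_ρ_eq_of_isConnectedObj surjective_of_isConnectedObj
  nonempty_of_isConnectedObj)

universe u v w

variable {G : Type u} [Group G] [TopologicalSpace G] {Q : Type v} [Group Q] {Λ : Type w}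
  [CommGroup Λ] (q : G →* Q) (ι : Λ →* Q) [ι.range.Normal]

/-! ### Evaluation at a point -/

section Eval

variable (E : BTemp G)

/-- Evaluation of compatible families at a point `x`, `Fam E → Λ`.
[cite: MochizukiEtTh2009, §5 p.327 (PDF p.101)] -/
def evalFam (x : E.obj.V) : Fam q ι E →* Λ :=
  (Pi.evalMonoidHom (fun _ : E.obj.V => Λ) x).comp (Fam q ι E).subtype

/-- `evalFam` on families. [cite: MochizukiEtTh2009, §5 p.327 (PDF p.101)] -/
@[simp] theorem evalFam_apply (x : E.obj.V) (t : Fam q ι E) :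
    evalFam q ι E x t = (t : E.obj.V → Λ) x := rfl

/-- **Evaluation at a point** `x`: `(l·Δ_Θ)_E → Λ/J(Stab x)`, the class of `t_x`.
[cite: MochizukiEtTh2009, §5 p.327 (PDF p.101)] -/
def evalAt (x : E.obj.V) : LDelta q ι E →* Carrier q ι (stabilizerSubgroup E x) :=
  QuotientGroup.map _ _ (evalFam q ι E x) fun t ht => by
    rw [Subgroup.mem_subgroupOf] at ht
    simpa [Subgroup.mem_comap] using ht x

/-- `evalAt` on classes. [cite: MochizukiEtTh2009, §5 p.327 (PDF p.101)] -/
@[simp] theorem evalAt_mk (x : E.obj.V) (t : Fam q ι E) :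
    evalAt q ι E x (mk q ι E t) = QuotientGroup.mk ((t : E.obj.V → Λ) x) := rfl

variable {E}

/-- A compatible family on a CONNECTED object that dies at one point dies everywhere (transport along the
transitive action; conjugation equivariance of `J`). [cite: MochizukiEtTh2009, §5 p.327 (PDF p.101)] -/
theorem mem_null_of_apply_mem (hE : IsConnectedObj E) {t : E.obj.V → Λ} (ht : t ∈ Fam q ι E)
    (x : E.obj.V) (hx : ι (t x) ∈ killQ q ι (stabilizerSubgroup E x)) : t ∈ Null q ι E := by
  intro x'
  obtain ⟨g, rfl⟩ := exists_ρ_eq_of_isConnectedObj E hE x x'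
  have h1 := ht g x
  have h2 : q g * ι (t x) * (q g)⁻¹ ∈ killQ q ι (stabilizerSubgroup E (E.obj.ρ g x)) :=
    conj_mem_killQ q ι (conj_mem_stabilizerSubgroup E g x) hx
  have h3 := (killQ q ι _).mul_mem h1 ((killQ q ι _).inv_mem h2)
  rw [mul_assoc, mul_inv_cancel, mul_one] at h3
  simpa using (killQ q ι _).inv_mem h3

/-- **`evalAt x` is injective on a connected object.**
[cite: MochizukiEtTh2009, §5 p.327 (PDF p.101)] -/
theorem evalAt_injective (hE : IsConnectedObj E) (x : E.obj.V) :
    Function.Injective (evalAt q ι E x) := by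
  rw [injective_iff_map_eq_one]
  intro a ha
  induction a using QuotientGroup.induction_on with
  | H t =>
    rw [evalAt_mk, QuotientGroup.eq_one_iff, Subgroup.mem_comap] at ha
    exact (QuotientGroup.eq_one_iff _).mpr (mem_null_of_apply_mem q ι hE t.2 x ha)

/-- The compatible family generated by a value `λ` at a base point of a connected object: at `g·x` take (a
lift to `Λ` of) `q(g)·ι(λ)·q(g)⁻¹`. [cite: MochizukiEtTh2009, §5 p.327 (PDF p.101)] -/
theorem exists_fam_apply_eq (hE : IsConnectedObj E) (x : E.obj.V) (a : Λ) :
    ∃ t ∈ Fam q ι E, (ι (t x))⁻¹ * ι a ∈ killQ q ι (stabilizerSubgroup E x) := by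
  classical
  -- choices: a transporter `γ x'` with `γ x' · x = x'`, and a lift of the conjugate of `ι a`
  have hγ : ∀ x' : E.obj.V, ∃ g : G, E.obj.ρ g x = x' := exists_ρ_eq_of_isConnectedObj E hE x
  choose γ hγ using hγ
  have hl : ∀ x' : E.obj.V, ∃ b : Λ, ι b = q (γ x') * ι a * (q (γ x'))⁻¹ := fun x' =>
    conj_mem_range ι (q (γ x')) a
  choose t ht using hl
  refine ⟨t, ?_, ?_⟩
  · intro g x'
    -- `γ (g·x')` and `g·γ x'` both carry `x` to `g·x'`: they differ by `Stab(x)` on the right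
    have hs : (γ (E.obj.ρ g x'))⁻¹ * (g * γ x') ∈ stabilizerSubgroup E x := by
      change E.obj.ρ ((γ (E.obj.ρ g x'))⁻¹ * (g * γ x')) x = x
      have e' := ρ_inv_apply E (γ (E.obj.ρ g x')) x
      rw [hγ (E.obj.ρ g x')] at e'
      rw [ρ_mul_apply, ρ_mul_apply, hγ x']
      exact e'
    rw [ht, ht]
    -- the commutator `⁅(ι a)⁻¹, q s⁆ ∈ J(Stab x)`, conjugated by `q (γ (g·x'))` into `J(Stab (g·x'))`
    have v : (ι a)⁻¹ * q ((γ (E.obj.ρ g x'))⁻¹ * (g * γ x')) * (ι a)⁻¹⁻¹ *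
        (q ((γ (E.obj.ρ g x'))⁻¹ * (g * γ x')))⁻¹ ∈ killQ q ι (stabilizerSubgroup E x) :=
      Subgroup.mem_sup_right (Subgroup.commutator_mem_commutator
        (ι.range.inv_mem (mem_range_self ι a)) (Subgroup.mem_map_of_mem q hs))
    have v' := conj_mem_killQ q ι (conj_mem_stabilizerSubgroup E (γ (E.obj.ρ g x')) x) v
    rw [hγ] at v'
    have key : (q (γ (E.obj.ρ g x')) * ι a * (q (γ (E.obj.ρ g x')))⁻¹)⁻¹ *
        (q g * (q (γ x') * ι a * (q (γ x'))⁻¹) * (q g)⁻¹) =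
        q (γ (E.obj.ρ g x')) * ((ι a)⁻¹ * q ((γ (E.obj.ρ g x'))⁻¹ * (g * γ x')) * (ι a)⁻¹⁻¹ *
          (q ((γ (E.obj.ρ g x'))⁻¹ * (g * γ x')))⁻¹) * (q (γ (E.obj.ρ g x')))⁻¹ := by
      simp only [map_mul, map_inv]
      group
    rw [key]
    exact v'
  · rw [ht]
    -- `γ x ∈ Stab(x)`
    have hs : γ x ∈ stabilizerSubgroup E x := hγ x
    have hc : (ι a)⁻¹ ∈ ι.range := ι.range.inv_mem (mem_range_self ι a)
    have v := conj_mul_inv_mem_killQ q ι (S := stabilizerSubgroup E x) hc hs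
    have key : (q (γ x) * ι a * (q (γ x))⁻¹)⁻¹ * ι a =
        q (γ x) * (ι a)⁻¹ * (q (γ x))⁻¹ * (ι a)⁻¹⁻¹ := by group
    rw [key]
    exact v

/-- **`evalAt x` is surjective on a connected object.**
[cite: MochizukiEtTh2009, §5 p.327 (PDF p.101)] -/
theorem evalAt_surjective (hE : IsConnectedObj E) (x : E.obj.V) :
    Function.Surjective (evalAt q ι E x) := by
  intro c
  induction c using QuotientGroup.induction_on with
  | H a =>
    obtain ⟨t, ht, hta⟩ := exists_fam_apply_eq q ι hE x a
    refine ⟨mk q ι E ⟨t, ht⟩, ?_⟩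
    rw [evalAt_mk, QuotientGroup.eq, Subgroup.mem_comap, map_mul, map_inv]
    exact hta

/-- **`(l·Δ_Θ)_E ≅ Λ/J(Stab x)`** for a connected object `E` and any point `x ∈ E`.
[cite: MochizukiEtTh2009, §5 p.327 (PDF p.101)] -/
def evalEquiv (hE : IsConnectedObj E) (x : E.obj.V) :
    LDelta q ι E ≃* Carrier q ι (stabilizerSubgroup E x) :=
  MulEquiv.ofBijective (evalAt q ι E x) ⟨evalAt_injective q ι hE x, evalAt_surjective q ι hE x⟩

/-- `evalEquiv` is `evalAt`. [cite: MochizukiEtTh2009, §5 p.327 (PDF p.101)] -/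
@[simp] theorem evalEquiv_apply (hE : IsConnectedObj E) (x : E.obj.V) (c : LDelta q ι E) :
    evalEquiv q ι hE x c = evalAt q ι E x c := rfl

end Eval

/-! ### The transport along a morphism is the natural surjection `Λ/J(Stab x) ↠ Λ/J(Stab (f x))` -/

section Transport

variable {E E' : BTemp G} (hE : IsConnectedObj E) (hE' : IsConnectedObj E')

/-- **`evalAt (f x) ∘ map f = proj ∘ evalAt x`**: under the point identifications the transport along
`f : E → E'` is the natural map `Λ/J(Stab x) → Λ/J(Stab(f x))` ("linear morphisms `S'' → S` … induce …",
p.328 (PDF p.102)). [cite: MochizukiEtTh2009, Prop 5.5 proof p.328 (PDF p.102)] -/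
theorem evalAt_map (f : E ⟶ E') (x : E.obj.V) (c : LDelta q ι E) :
    evalAt q ι E' (f.hom.hom x) (map q ι hE hE' f c) =
      proj q ι (stabilizerSubgroup_le_of_hom f x) (evalAt q ι E x c) := by
  induction c using QuotientGroup.induction_on with
  | H t =>
    rw [map_mk, evalAt_mk, evalAt_mk, proj_mk, QuotientGroup.eq, Subgroup.mem_comap, map_mul, map_inv]
    exact famPush_apply_congr q ι hE hE' f t x

/-- **The transport along a morphism of connected objects is surjective** (hence, on `(−) ⊗ ℤ/Nℤ` and
under Def. 5.4 (b), bijective: `ThetaSubquotientGroup.modPowMap_bijective_of_card_eq`).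
[cite: MochizukiEtTh2009, Prop 5.5 proof p.328 (PDF p.102)] -/
theorem map_surjective (f : E ⟶ E') : Function.Surjective (map q ι hE hE' f) := by
  obtain ⟨x⟩ := nonempty_of_isConnectedObj E hE
  intro c'
  obtain ⟨c₁, hc₁⟩ := proj_surjective q ι (stabilizerSubgroup_le_of_hom f x)
    (evalAt q ι E' (f.hom.hom x) c')
  obtain ⟨c, rfl⟩ := evalAt_surjective q ι hE x c₁
  refine ⟨c, evalAt_injective q ι hE' (f.hom.hom x) ?_⟩
  rw [evalAt_map, hc₁]

/- Functoriality (`map (𝟙 E) = id`, `map (f ≫ g) = map g ∘ map f`) is NOT restated here: it is already in the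
tree as `ThetaSubquotient.map_id` / `ThetaSubquotient.map_comp` (abc-iut-w4-d008,
`Discharge/Sec5TransportLaws.lean`, p418890); abc-iut-L2-t9's staged proofs via `evalAt_map` were dropped at filing
(abc-iut-w4-d042 g3) to avoid the duplicate fully-qualified names. -/

end Transport

/-! ### Galois points -/

omit [TopologicalSpace G] in
/-- At a stabiliser `S` with `q(S)` normal in `Q` (a Galois object `Π/N`, `q` surjective), `ι⁻¹J(S) =
ι⁻¹(q(S) ∩ L)`: the carrier `Λ/J(S)` is print's `L·q(S)/q(S) ≅ L/(L ∩ q(S))`, the image of `l·Δ_Θ` in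
`Aut^Θ_D(Π/S) = Q/q(S)`. [cite: MochizukiEtTh2009, §5 p.327 (PDF p.101)] -/
theorem kill_eq_of_normal {S : Subgroup G} [(S.map q).Normal] :
    kill q ι S = (S.map q ⊓ ι.range).comap ι := by
  rw [kill, killQ_eq_of_normal]

omit [TopologicalSpace G] in
/-- At a Galois point, a class in `Λ/J(Stab x)` is trivial iff its image lies in `q(Stab x)`.
[cite: MochizukiEtTh2009, §5 p.327 (PDF p.101)] -/
theorem mk_eq_one_iff_of_normal {S : Subgroup G} [(S.map q).Normal] (a : Λ) :
    (QuotientGroup.mk a : Carrier q ι S) = 1 ↔ ι a ∈ S.map q := by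
  rw [QuotientGroup.eq_one_iff, kill_eq_of_normal, Subgroup.mem_comap, Subgroup.mem_inf]
  exact ⟨fun h => h.1, fun h => ⟨h, mem_range_self ι a⟩⟩

end ThetaSubquotient

end Literature.AnabelianGeometry.EtaleTheta

end
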